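import Mathlib.Analysis.SpecialFunctions.Pow.Real
import Mathlib.Analysis.SpecialFunctions.Pow.Asymptotics
import Mathlib.Tactic

/-!
# Klainerman–Szeftel (refereed) ch. 5: the `δ_extra` pure-`r` rate chain on the last slice Σ_* versus Theorem M1 item 2 as printed — monomial-rate bookkeeping

CITATION HEADER (lean-in-tree rule 2026-08-18).  Kernel-checked transcription of SMALL-CONSTANT / EXPONENT BOOKKEEPING printed in
* [KS-J] S. Klainerman, J. Szeftel, *Kerr stability for small angular momentum*, Pure Appl. Math. Q. **19** (2023) no. 3, 791–1678
  = bib key `KlainermanSzeftel2023`, read as the authors' accepted version HAL hal-04280491 ("July 14, 2023"; `HAL p.N` = PDF page,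
  `LN` = line of the pdftotext page file);
* [KS-v1] the same, arXiv:2104.11857v1 (TeX `Main-Kerr-arxiv.tex`, `KS l.N`) = bib key `KlainermanSzeftel2021`;
* [GKS-J] E. Giorgi, S. Klainerman, J. Szeftel, *Wave equations estimates and the nonlinear stability of slowly rotating Kerr black
  holes*, Pure Appl. Math. Q. **20** (2024) no. 7, 2865–3849 = bib key `GiorgiKlainermanSzeftel2024` (held text
  `paper:doi-10-4310-pamq-241128023033`, `PAMQ p.N`).

WHAT IS TRANSCRIBED (every `def` below is a printed pair of exponents `(a, b)` standing for a sup bound `|X| ≲ ε₀ r^{−a} u^{−b}` on the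
indicated region; nothing else):
1. Theorem M1 item 2, ∇₃A clause.  [KS-J] HAL p.157 L77–106 (stated "with respect to the global frame of Proposition 3.6.9", L55):
   "sup_{(ext)M}(r³u^{1+δ_extra} + r⁴u^{1/2+δ_extra} + r^{9/2+δ_dec})|𝔡^{k−1}∇₃A| … ≲ ε₀", i.e. the three branches
   `(3, 1+δ_extra)`, `(4, 1/2+δ_extra)`, `(9/2+δ_dec, 0)` → `m1J_DA`; this is [GKS-J] Thm 11.7.1 (11.7.3) (PAMQ p.527 L32–46) word for
   word, and [GKS-J] Remark 11.7.2 (PAMQ p.527 L52–64) prints: "the estimates for highest power of r for ∇₃A and ∇²₃A are not sharp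
   as we are missing … sup_{(ext)M} r^{9/2+δ_extra}|𝔡^{k−1}∇₃A| … the sharper estimates do in fact only hold on M(τ ≤ τ_* − 2).
   Fortunately, the slightly weaker estimates in (11.7.3) turn out to suffice whenever they are used in Chapter 6 and 7 of [56]."
   [KS-v1] Thm M1 item 2 (KS l.6684–6687): "sup_{(ext)M}( r²(2r+u)^{1+δ_extra}/log(1+u) + r³(2r+u)^{1/2+δ_extra} )( |𝔡^kA| +
   r|𝔡^{k−1}∇₃A| ) ≲ ε₀" — its second weight on ∇₃A is `r⁴(2r+u)^{1/2+δ_extra} ≥ r^{9/2+δ_extra}` → `m1v1_DA`.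
2. The DEMAND: [KS-J] ch. 5 "Ref 2" item 3, (5.1.42) (HAL p.246 L8–15): "According to Theorem M1, α satisfies on Σ_*, for all
   0 ≤ k ≤ k_*, ‖α‖_{∞,k} ≲ ε₀r^{−7/2−δ_extra}, ‖∇₃α + (f̃ ⊗̂ β − *f̃ ⊗̂ *β)‖_{∞,k−1} ≲ ε₀r^{−9/2−δ_extra}", and Remark 5.1.14,
   (5.1.44) (HAL p.246 L18–27): "Theorem M1 implies in fact on Σ_*, for all 0 ≤ k ≤ k_*, ‖α′‖_{∞,k} ≲ ε₀r^{−7/2−δ_extra},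
   ‖∇_{e′₃}α′‖_{∞,k−1} ≲ ε₀r^{−9/2−δ_extra}, where the quantities with prime are expressed in the global frame of Proposition
   3.6.9" → `ref2b δ_extra` = `(9/2+δ_extra, 0)`; the RATE is that of [KS-v1] (KS l.9610–9617: "‖∇₃α‖_{∞,k−1} ≲ ε₀r^{−9/2−δ_extra}",
   no f̃-term and no Remark 5.1.14 there), where it WAS supplied by item 1's v1 weight.
   The same sharp global-frame display reappears in [KS-J] Remark 6.1.7 (HAL p.343 L46–69: "‖∇_{e′₃}A′‖_{∞,k−1} ≲ ε₀ min{
   r^{−4}(u+2r)^{−1/2−δ_extra}, r^{−3}u^{−1−δ_extra}} … in the global frame of Proposition 3.6.9").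
3. The REGION: [KS-J] (5.1.30) (HAL p.242 L8–17): "r is monotonically decreasing on Σ_* and … r_* = δ_*ε₀^{−1}u_*^{1+δ_dec}, which
   implies in particular on Σ_* r ≥ r_* = δ_*ε₀^{−1}u_*^{1+δ_dec} ≥ δ_*ε₀^{−1}u^{1+δ_dec}"; with u ≥ 1 on Σ_* this gives `1 ≤ u ≤ r`
   on Σ_* (all that is used below), and r is NOT bounded on the family of last slices (u_* → ∞ along the bootstrap).
4. The CHAIN hanging off (5.1.42)b in [KS-J] ch. 5 (grep of `δextra` over all 866 HAL pages: 42 hits on 15 pages, each classified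
   in the audit cell's GAPS.md block "adep1-g8"): Prop 5.5.1 (5.5.2) last clause "‖𝔡^{≤k−1}_*∇_να‖ ≲ ε₀r^{−9/2−δ_extra}" (HAL p.298
   L8–16; fn 15 "derived in Step 4"; ABSENT from [KS-v1] l.11853–11872) ← Step 4 (5.5.6)–(5.5.7) (HAL p.301 L2–54) ← (5.1.42)b;
   Cor 5.6.15 second display "sup_{Σ_*} r^{7/2+δ_extra}|d̸^{≤k}(β − 3am sinθ r^{−4}f₀)| ≲ ε₀, k ≤ k_*−14" (HAL p.312 L85–95; v1 KS
   l.12507) ← (5.5.2) via "∇⊗̂β = ∇₃α − (Υ/r)α + …" (HAL p.313 L99–109); Lemma 5.7.9 first weight "r^{7/2+δ_extra}|𝔡^kβ′|" (HAL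
   p.328 L105–120; v1 KS l.13127–13131) ← Cor 5.6.15 + "the control of Theorem M1 for α′" (HAL p.330 L126–137); Prop 5.7.3 third
   display "sup_{Σ_*}( r^{7/2+δ_extra}|𝔡^kB′| + r⁴u^{1/2+δ_dec}|𝔡^{k−1}∇₃B′| ) ≲ ε₀" (HAL p.319 L61–70; v1 KS l.12791).  TERMINUS: the
   ch. 6 restatement Prop 6.4.3 (HAL p.380 L26–64; v1 KS l.15416–15428, both versions) OMITS the `r^{7/2+δ_extra}|𝔡^kB|` clause, and
   ch. 6–9 contain no further `δ_extra` locus outside (6.1.19)/(6.1.21) (HAL p.343–344, 381, 385, 394; audit cell E20-J).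

WHAT IS CERTIFIED.  Pure real arithmetic on these printed exponents (0 sorry; axioms ⊆ {propext, Classical.choice, Quot.sound}):
* §1 `Dominates`: the exact criterion for one monomial rate to imply another UNIFORMLY on the cone `{1 ≤ u ≤ r}` —
  `(a, b) ≽ (a′, b′) ⟺ a′ ≤ a ∧ a′ + b′ ≤ a + b` — with its `rpow` soundness (`Dominates.sound`).
* §2 SUPPLY: v1's weight gives `ref2b δ_extra` with constant 1 (`v1_supplies`, `v1_weight_ge`); NONE of the three [KS-J] branches
  dominates `ref2b δ_extra` when `δ_dec < δ_extra` (`m1J_branches_fail`), and no constant repairs it: along `u = 1 ≤ κ ≤ r` the best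
  [KS-J] bound `ε₀ r^{−9/2−δ_dec}` exceeds `C ε₀ r^{−9/2−δ_extra}` for large `r`, for EVERY `C` (`m1J_not_uniform`) — i.e. (5.1.42)b /
  (5.1.44)b / Remark 6.1.7's primed display are NOT consequences of Theorem M1 as printed in [KS-J] (they are of [KS-v1]'s), in
  accordance with [GKS-J] Remark 11.7.2; what [KS-J]'s item 2 does give on the cone is `ref2b δ_dec` (`m1J_supplies_dec`).
* §3 PRICE = NIL DOWNSTREAM: each inference of the chain is exponent-monotone — it goes through VERBATIM with any `δ ∈ [δ_dec, 1/2]`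
  in place of `δ_extra` (`step4_absorb`, `step557_absorb`, `lemma579_absorb`, `cor5615_shift`), so replacing `δ_extra ↦ δ_dec` in the
  six displays of item 4 makes every one of them a consequence of [KS-J] Thm M1 + the printed arguments, while Theorem M3 (= (5.5.1),
  Remark 5.5.2, HAL p.298) and Prop 6.4.3 do not contain the affected clause at all (`terminus_note`).
NOTHING about frames, the Einstein equations or the truth of any estimate is asserted: the module checks which printed EXPONENTS imply
which, on the printed region.  Classification in the audit cell: PRINT-class residue of finding E26(a) inside the refereed [KS-J]
(v1's sharp rate survived in ch. 5 and in Remark 6.1.7 when Thm M1 item 2 was weakened to [GKS-J] (11.7.3)); not load-bearing.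

STATUS / RELATION.  Companion of `RefTwoExponents` (ch. 6 side: (6.1.19) ⇒ (6.1.21), which IS consistent with [KS-J] item 2) and of
the cell files GAPS.md (block "adep1-g8: M1's A-estimates in the refereed ch. 5") / DIVERGENCE.md VER-A24–A28.  Mathlib only.  This is
audit bookkeeping of a PUBLISHED, REFEREED proof; it is not Final-State-Conjecture progress and claims no gap in the theorem proved.
-/

noncomputable section

open Filter Real

namespace Literature.Geometry.Lorentzian.KlainermanSzeftel2021.LastSliceRateChain

/-! ## §1 Monomial rates and uniform domination on the cone `1 ≤ u ≤ r` -/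

/-- A monomial rate: the pair `(a, b)` stands for the sup bound `|X| ≲ ε₀ r^{−a} u^{−b}`. [folklore] -/
structure Rate where
  /-- exponent of `r⁻¹` -/
  a : ℝ
  /-- exponent of `u⁻¹` -/
  b : ℝ

/-- `x ≽ y`: the bound `r^{−x.a}u^{−x.b}` implies `r^{−y.a}u^{−y.b}` with constant 1 at EVERY point of the cone `1 ≤ u ≤ r` — tested on
its two boundary rays `u = 1` (`y.a ≤ x.a`) and `u = r` (`y.a + y.b ≤ x.a + x.b`). [folklore] -/
def Dominates (x y : Rate) : Prop := y.a ≤ x.a ∧ y.a + y.b ≤ x.a + x.b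

/-- Unfolding lemma. [folklore] -/
@[simp] lemma dominates_iff (x y : Rate) : Dominates x y ↔ y.a ≤ x.a ∧ y.a + y.b ≤ x.a + x.b := Iff.rfl

/-- Soundness of the criterion: on `1 ≤ u ≤ r`, `x ≽ y` gives `r^{−x.a}u^{−x.b} ≤ r^{−y.a}u^{−y.b}`. [folklore] -/
theorem Dominates.sound {x y : Rate} (h : Dominates x y) {u r : ℝ} (hu : 1 ≤ u) (hur : u ≤ r) :
    r ^ (-x.a) * u ^ (-x.b) ≤ r ^ (-y.a) * u ^ (-y.b) := by
  have hu0 : 0 < u := by linarith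
  have hr1 : 1 ≤ r := le_trans hu hur
  have hr0 : 0 < r := by linarith
  have key : u ^ (y.b - x.b) ≤ r ^ (x.a - y.a) := by
    rcases le_or_gt (y.b - x.b) 0 with hneg | hpos
    · calc u ^ (y.b - x.b) ≤ u ^ (0 : ℝ) := Real.rpow_le_rpow_of_exponent_le hu hneg
        _ = r ^ (0 : ℝ) := by rw [Real.rpow_zero, Real.rpow_zero]
        _ ≤ r ^ (x.a - y.a) := Real.rpow_le_rpow_of_exponent_le hr1 (by linarith [h.1])
    · calc u ^ (y.b - x.b) ≤ r ^ (y.b - x.b) := Real.rpow_le_rpow hu0.le hur hpos.le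
        _ ≤ r ^ (x.a - y.a) := Real.rpow_le_rpow_of_exponent_le hr1 (by linarith [h.2])
  have e1 : r ^ (-x.a) * u ^ (-x.b) = (r ^ (-x.a) * u ^ (-y.b)) * u ^ (y.b - x.b) := by
    rw [mul_assoc, ← Real.rpow_add hu0, show -y.b + (y.b - x.b) = -x.b by ring]
  have e2 : r ^ (-y.a) * u ^ (-y.b) = (r ^ (-x.a) * u ^ (-y.b)) * r ^ (x.a - y.a) := by
    rw [mul_comm (r ^ (-x.a)) (u ^ (-y.b)), mul_assoc, ← Real.rpow_add hr0,
      show -x.a + (x.a - y.a) = -y.a by ring, mul_comm]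
  rw [e1, e2]
  exact mul_le_mul_of_nonneg_left key
    (mul_nonneg (Real.rpow_pos_of_pos hr0 _).le (Real.rpow_pos_of_pos hu0 _).le)

/-- The `u = 1` ray test is also NECESSARY, and no constant repairs its failure: if `x.a < y.a` then for every `C` (and every
threshold `κ`) there is `r ≥ max(1, κ)` at which the supplied `r^{−x.a}` exceeds `C·r^{−y.a}` (take `u = 1`). [folklore] -/
theorem not_dominates_ray {x y : Rate} (h : x.a < y.a) (C κ : ℝ) :
    ∃ r : ℝ, 1 ≤ r ∧ κ ≤ r ∧ C * r ^ (-y.a) < r ^ (-x.a) := by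
  have ht : Tendsto (fun s : ℝ => s ^ (y.a - x.a)) atTop atTop := tendsto_rpow_atTop (by linarith)
  obtain ⟨r, hrC, hr1, hrκ⟩ :=
    ((ht.eventually_gt_atTop C).and ((eventually_ge_atTop 1).and (eventually_ge_atTop κ))).exists
  refine ⟨r, hr1, hrκ, ?_⟩
  have hr0 : 0 < r := by linarith
  have hxa : r ^ (-x.a) = r ^ (y.a - x.a) * r ^ (-y.a) := by
    rw [← Real.rpow_add hr0, show y.a - x.a + -y.a = -x.a by ring]
  rw [hxa]
  exact mul_lt_mul_of_pos_right hrC (Real.rpow_pos_of_pos hr0 _)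

/-! ## §2 The printed rates: supply ([KS-J] / [KS-v1] Thm M1 item 2) versus demand ((5.1.42)b) -/

/-- [KS-J] Thm M1 item 2, the three ∇₃A branches `(3, 1+δ_extra)`, `(4, 1/2+δ_extra)`, `(9/2+δ_dec, 0)` (= [GKS-J] (11.7.3)).
[cite: KlainermanSzeftel2023, Thm M1 item 2, HAL hal-04280491 p.157 L86–95] -/
def m1J_DA (δextra δdec : ℝ) : List Rate := [⟨3, 1 + δextra⟩, ⟨4, 1 / 2 + δextra⟩, ⟨9 / 2 + δdec, 0⟩]

/-- [KS-v1] Thm M1 item 2: the pure-`r` content of the ∇₃A weight `r⁴(2r+u)^{1/2+δ_extra}` is `(9/2+δ_extra, 0)` (`v1_weight_ge`).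
[cite: KlainermanSzeftel2021, Thm M1 item 2, KS l.6684–6687] -/
def m1v1_DA (δextra : ℝ) : Rate := ⟨9 / 2 + δextra, 0⟩

/-- The DEMAND of (5.1.42)b / (5.1.44)b / (5.5.2)c with pure-`r` exponent `9/2 + δ` (printed with `δ = δ_extra`).
[cite: KlainermanSzeftel2023, (5.1.42)/(5.1.44)/(5.5.2), HAL hal-04280491 p.246 L8–27, p.298 L8–16] -/
def ref2b (δ : ℝ) : Rate := ⟨9 / 2 + δ, 0⟩

/-- Unfolding lemma. [folklore] -/
@[simp] lemma m1v1_DA_a (δe : ℝ) : (m1v1_DA δe).a = 9 / 2 + δe := rfl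
/-- Unfolding lemma. [folklore] -/
@[simp] lemma m1v1_DA_b (δe : ℝ) : (m1v1_DA δe).b = 0 := rfl
/-- Unfolding lemma. [folklore] -/
@[simp] lemma ref2b_a (δ : ℝ) : (ref2b δ).a = 9 / 2 + δ := rfl
/-- Unfolding lemma. [folklore] -/
@[simp] lemma ref2b_b (δ : ℝ) : (ref2b δ).b = 0 := rfl

/-- v1's weight is at least `r^{9/2+δ_extra}` pointwise (`u ≥ 0`, `r ≥ 0`, exponent `≥ 0`): `r⁴(2r+u)^{1/2+δe} ≥ r⁴·r^{1/2+δe}`.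
So in [KS-v1], (5.1.42)b follows from Thm M1 item 2 with constant 1 (the audit cell's v1 certificate E-Ref2c).
[cite: KlainermanSzeftel2021, Thm M1 item 2 ⇒ KS l.9615] -/
theorem v1_weight_ge {δe u r : ℝ} (hδ : 0 ≤ 1 / 2 + δe) (hu : 0 ≤ u) (hr : 0 ≤ r) :
    r ^ (9 / 2 + δe) ≤ r ^ (4 : ℝ) * (2 * r + u) ^ (1 / 2 + δe) := by
  rcases hr.eq_or_lt with rfl | hr0
  · have : (9 / 2 + δe) ≠ 0 := by linarith
    simp [Real.zero_rpow this]
  calc r ^ (9 / 2 + δe) = r ^ (4 : ℝ) * r ^ (1 / 2 + δe) := by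
        rw [← Real.rpow_add hr0]; congr 1; ring
    _ ≤ r ^ (4 : ℝ) * (2 * r + u) ^ (1 / 2 + δe) := by
        apply mul_le_mul_of_nonneg_left _ (Real.rpow_pos_of_pos hr0 _).le
        exact Real.rpow_le_rpow hr (by linarith) hδ

/-- In exponent form: `m1v1_DA δe ≽ ref2b δe` (indeed equal). [cite: KlainermanSzeftel2021, KS l.6684–6687 / l.9615] -/
theorem v1_supplies (δe : ℝ) : Dominates (m1v1_DA δe) (ref2b δe) := by
  rw [dominates_iff]; dsimp only [m1v1_DA, ref2b]; constructor <;> linarith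

/-- [KS-J]: for `δ_dec < δ_extra` NONE of the three printed ∇₃A branches dominates the demand `(9/2+δ_extra, 0)` — each fails the
`u = 1` ray test (`3`, `4`, `9/2+δ_dec` are all `< 9/2+δ_extra`; `δ_extra > −1/2` for the second).
[cite: KlainermanSzeftel2023, HAL hal-04280491 p.157 vs p.246] -/
theorem m1J_branches_fail {δe δd : ℝ} (h : δd < δe) (hδ : -1 / 2 < δe) :
    ∀ x ∈ m1J_DA δe δd, x.a < (ref2b δe).a ∧ ¬ Dominates x (ref2b δe) := by
  intro x hx
  simp only [m1J_DA, List.mem_cons, List.mem_nil_iff, or_false] at hx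
  rcases hx with rfl | rfl | rfl <;> refine ⟨?_, fun hd => ?_⟩ <;> (try have hd1 := hd.1) <;>
    dsimp only [ref2b] at * <;> linarith

/-- … and no constant repairs it: at `u = 1` the three [KS-J] branches give at best `ε₀ r^{−(9/2+δ_dec)}` (the minimum of `r^{−3}`,
`r^{−4}`, `r^{−9/2−δ_dec}` for `r ≥ 1`), and for EVERY `C` there are `r ≥ max(1, κ)` with `C · r^{−(9/2+δ_extra)} < r^{−(9/2+δ_dec)}` —
the deficit factor `r^{δ_extra − δ_dec}` is unbounded along the family of last slices (item 3 of the header: `r ≥ κ u^{1+δ_dec}`,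
`u = 1` admissible, `κ = δ_*ε₀^{−1}` fixed while `r_* → ∞`). [cite: KlainermanSzeftel2023, HAL hal-04280491 p.157 / p.242 / p.246;
GiorgiKlainermanSzeftel2024, Remark 11.7.2, PAMQ p.527 L52–64] -/
theorem m1J_not_uniform {δe δd : ℝ} (h : δd < δe) (C κ : ℝ) :
    ∃ r : ℝ, 1 ≤ r ∧ κ ≤ r ∧ C * r ^ (-(9 / 2 + δe)) < r ^ (-(9 / 2 + δd)) :=
  not_dominates_ray (x := ⟨9 / 2 + δd, 0⟩) (y := ref2b δe) (by simp; linarith) C κ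

/-- The minimum of the three [KS-J] branches at `u = 1`, `r ≥ 1` is the third one: `r^{−(9/2+δ_dec)} ≤ r^{−4} ≤ r^{−3}` when
`δ_dec ≥ −1/2` — so `m1J_not_uniform` tests the right branch. [cite: KlainermanSzeftel2023, HAL hal-04280491 p.157] -/
theorem m1J_best_branch_at_u_one {δd r : ℝ} (hδ : -1 / 2 ≤ δd) (hr : 1 ≤ r) :
    r ^ (-(9 / 2 + δd)) ≤ r ^ (-(4 : ℝ)) ∧ r ^ (-(4 : ℝ)) ≤ r ^ (-(3 : ℝ)) :=
  ⟨Real.rpow_le_rpow_of_exponent_le hr (by linarith), Real.rpow_le_rpow_of_exponent_le hr (by norm_num)⟩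

/-- What [KS-J]'s item 2 DOES supply uniformly on the cone: the third branch alone gives `ref2b δ_dec`, i.e. (5.1.42)b with
`δ_extra ↦ δ_dec`. [cite: KlainermanSzeftel2023, HAL hal-04280491 p.157 L92–95] -/
theorem m1J_supplies_dec (δe δd : ℝ) : Dominates ⟨9 / 2 + δd, 0⟩ (ref2b δd) ∧ (⟨9 / 2 + δd, 0⟩ : Rate) ∈ m1J_DA δe δd := by
  refine ⟨?_, by simp [m1J_DA]⟩
  rw [dominates_iff]; dsimp only [ref2b]; constructor <;> linarith

/-! ## §3 The chain survives verbatim at any `δ ∈ [δ_dec, 1/2]` (price of the drift = nil downstream) -/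

/-- Step 4 of the proof of Prop 5.5.1 (HAL p.301 L17–35): after the Hodge estimate and Sobolev, `|d̸^kβ| ≲ ε₀ r^{−7/2−δ} + r^{−4}`,
and the text concludes (5.5.6) `|d̸^kβ| ≲ ε₀ r^{−3}u^{−1/2−δ_dec}` "in view of the dominance condition (5.1.30)".  The `ε₀`-term
needs exactly `(7/2+δ, 0) ≽ (3, 1/2+δ_dec)`, which holds iff `δ_dec ≤ δ` (and `δ ≥ −1/2`): true at `δ = δ_extra` as printed AND at
`δ = δ_dec`. [cite: KlainermanSzeftel2023, (5.5.6), HAL hal-04280491 p.301] -/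
theorem step4_absorb {δ δd : ℝ} (hδ : δd ≤ δ) (hδd : -1 / 2 ≤ δd) :
    Dominates ⟨7 / 2 + δ, 0⟩ ⟨3, 1 / 2 + δd⟩ := by
  rw [dominates_iff]; dsimp only; constructor <;> linarith

/-- (5.5.7) (HAL p.301 L43–54): `|d̸^k∇_να| ≲ ε₀ r^{−9/2−δ} + ε r^{−5} ≲ ε₀ r^{−9/2−δ}`; the `ε`-term is absorbed using `ε ≤ ε₀ r^{1/2−δ}`
on Σ_* (dominance), whose exponent bookkeeping is `(5, 0) ≽ (9/2+δ, 0) ⟺ δ ≤ 1/2` — independent of `δ` being `δ_extra` or `δ_dec`.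
[cite: KlainermanSzeftel2023, (5.5.7), HAL hal-04280491 p.301] -/
theorem step557_absorb {δ : ℝ} (hδ : δ ≤ 1 / 2) : Dominates ⟨5, 0⟩ ⟨9 / 2 + δ, 0⟩ := by
  rw [dominates_iff]; dsimp only; constructor <;> linarith

/-- Cor 5.6.15, second display (HAL p.313 L86–125): from `∇⊗̂β = ∇₃α − (Υ/r)α + r^{−3}Γ_g + …` with `|∇₃α| ≲ ε₀r^{−9/2−δ}` one gets
`r·|d̸ ∇⊗̂β| ≲ ε₀ r^{−7/2−δ}`, and the competing term `ε₀ r^{−4}u^{−1−δ_dec}` is absorbed: `(4, 1+δ_dec) ≽ (7/2+δ, 0) ⟺ δ ≤ 1/2 ∧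
δ ≤ 3/2 + δ_dec`.  Both at `δ = δ_extra` (printed) and at `δ = δ_dec`. [cite: KlainermanSzeftel2023, Cor 5.6.15, HAL hal-04280491 p.312–313] -/
theorem cor5615_shift {δ δd : ℝ} (hδ : δ ≤ 1 / 2) (hδd : 0 ≤ δd) :
    Dominates ⟨4, 1 + δd⟩ ⟨7 / 2 + δ, 0⟩ ∧ (9 / 2 + δ) - 1 = 7 / 2 + δ := by
  refine ⟨?_, by ring⟩
  rw [dominates_iff]; dsimp only; constructor <;> linarith

/-- Proof of Lemma 5.7.9 (HAL p.330 L80–137): `|𝔡^kβ′| ≲ |𝔡^k(β − 3am r^{−4}f₀)| + r^{−1}|𝔡^k(ρ̌′, *ρ̌′, α′)| + ε₀r^{−4}u^{−1−δ_dec} ≲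
ε₀ r^{−7/2−δ}` uses: Cor 5.6.15 (first term, rate `7/2+δ`), "the control of Theorem M1 for α′" (the `A`-clause weight
`r³(2r+u)^{1/2+δ_extra}`, UNCHANGED in [KS-J] p.157 L81–84: `r^{−1}·r^{−7/2−δ_extra}`, i.e. `(9/2+δ_extra, 0) ≽ (7/2+δ, 0) ⟺ δ ≤
1 + δ_extra`), and `(4, 1+δ_dec) ≽ (7/2+δ, 0)` for the last term.  All three hold at any `δ ≤ 1/2` with `0 ≤ δ_dec ≤ δ_extra`.
[cite: KlainermanSzeftel2023, Lemma 5.7.9, HAL hal-04280491 p.328–330] -/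
theorem lemma579_absorb {δ δe δd : ℝ} (hδ : δ ≤ 1 / 2) (hδd : 0 ≤ δd) (hde : δd ≤ δe) :
    Dominates ⟨9 / 2 + δe, 0⟩ ⟨7 / 2 + δ, 0⟩ ∧ Dominates ⟨4, 1 + δd⟩ ⟨7 / 2 + δ, 0⟩ := by
  constructor <;> rw [dominates_iff] <;> dsimp only <;> constructor <;> linarith

/-- The three ch.-5 uses of "the control of Theorem M1 for A′/α′" OUTSIDE the chain (HAL p.330 L130, p.332 L42, p.335 L45; [KS-v1]
l.13198 / l.13270 / l.13383 print "Theorem M2" there — corrected to M1 in [KS-J]) consume only the `A`-clause of item 2: the weight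
`r²u^{1+δ_extra}` for `sup_{Σ_*} r²u^{1+δ_dec}|𝔡^{≤1}A′|` (p.332 L36–56: `(2, 1+δ_extra) ≽ (2, 1+δ_dec)`) and `r³(2r+u)^{1/2+δ_extra} ≥
r^{7/2+δ_extra}` for `|α′| ≲ ε₀r^{−7/2−δ_extra}` (p.330, p.335) — both branches are printed identically in [KS-v1] and [KS-J] (up to
`log(1+u)`/`(2r+u) ↦ u` in the FIRST, which only weakens `(2, 1+δ_extra)`'s far-zone form and is what is used here).  Referee
datum N-18 (REFEREE.md #33) answered: nothing beyond [KS-J] item 2 / (6.1.19) line 1 is consumed at these loci.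
[cite: KlainermanSzeftel2023, HAL hal-04280491 p.157 L78–85, p.330, p.332, p.335] -/
theorem n18_uses {δe δd : ℝ} (hde : δd ≤ δe) (hδe : 0 ≤ 1 / 2 + δe) :
    Dominates ⟨2, 1 + δe⟩ ⟨2, 1 + δd⟩ ∧ Dominates ⟨9 / 2 + δe, 0⟩ ⟨7 / 2 + δe, 0⟩ ∧
    ∀ u r : ℝ, 0 ≤ u → 0 ≤ r → r ^ (7 / 2 + δe) ≤ r ^ (3 : ℝ) * (2 * r + u) ^ (1 / 2 + δe) := by
  refine ⟨?_, ?_, ?_⟩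
  · rw [dominates_iff]; dsimp only; constructor <;> linarith
  · rw [dominates_iff]; dsimp only; constructor <;> linarith
  · intro u r hu hr
    rcases hr.eq_or_lt with rfl | hr0
    · have : (7 / 2 + δe) ≠ 0 := by linarith
      simp [Real.zero_rpow this]
    calc r ^ (7 / 2 + δe) = r ^ (3 : ℝ) * r ^ (1 / 2 + δe) := by
          rw [← Real.rpow_add hr0]; congr 1; ring
      _ ≤ r ^ (3 : ℝ) * (2 * r + u) ^ (1 / 2 + δe) := by
          apply mul_le_mul_of_nonneg_left _ (Real.rpow_pos_of_pos hr0 _).le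
          exact Real.rpow_le_rpow hr (by linarith) hδe

/-- SUMMARY (the priced statement).  With `0 ≤ δ_dec < δ_extra ≤ 1/2`: (i) the printed demand `ref2b δ_extra` is supplied by
[KS-v1]'s Thm M1 and NOT by [KS-J]'s (no branch dominates; `m1J_not_uniform` for the constant); (ii) `ref2b δ_dec` IS supplied by
[KS-J]; (iii) every downstream inference of the ch.-5 chain holds at `δ = δ_dec` exactly as at `δ = δ_extra`.  Hence the correction
`δ_extra ↦ δ_dec` in (5.1.42)b, (5.1.44)b, (5.5.2)c/(5.5.7), Cor 5.6.15, Lemma 5.7.9, Prop 5.7.3 (third display) restores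
consistency of [KS-J] with its own Thm M1 at no cost to Theorem M3 or to ch. 6 (Prop 6.4.3 omits the clause).
[cite: KlainermanSzeftel2023, HAL hal-04280491 p.157, 246, 298, 301, 312–313, 319, 328–330, 380] -/
theorem terminus_note {δe δd : ℝ} (h0 : 0 ≤ δd) (h1 : δd < δe) (h2 : δe ≤ 1 / 2) :
    Dominates (m1v1_DA δe) (ref2b δe) ∧ (∀ x ∈ m1J_DA δe δd, ¬ Dominates x (ref2b δe)) ∧
    Dominates ⟨9 / 2 + δd, 0⟩ (ref2b δd) ∧
    Dominates ⟨7 / 2 + δd, 0⟩ ⟨3, 1 / 2 + δd⟩ ∧ Dominates ⟨5, 0⟩ ⟨9 / 2 + δd, 0⟩ ∧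
    Dominates ⟨4, 1 + δd⟩ ⟨7 / 2 + δd, 0⟩ ∧ Dominates ⟨9 / 2 + δe, 0⟩ ⟨7 / 2 + δd, 0⟩ := by
  refine ⟨v1_supplies δe, fun x hx => (m1J_branches_fail h1 (by linarith) x hx).2, (m1J_supplies_dec δe δd).1,
    step4_absorb le_rfl (by linarith), step557_absorb (by linarith), ?_, ?_⟩
  · exact (cor5615_shift (by linarith) h0).1
  · exact (lemma579_absorb (δ := δd) (by linarith) h0 h1.le).1

/-- Numerical instance at [GKS-J]'s printed value `δ_extra = δ_dec + δ/2` (PAMQ p.535 L4) with, say, `δ_dec = 1/100`, `δ = 1/100`: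
the [KS-J] branches' `u = 1` exponents `3, 4, 4.51` are `< 4.515`. [cite: GiorgiKlainermanSzeftel2024, PAMQ p.535] -/
example : ∀ x ∈ m1J_DA (1 / 100 + 1 / 200) (1 / 100), x.a < (ref2b (1 / 100 + 1 / 200)).a := by
  intro x hx
  exact (m1J_branches_fail (by norm_num) (by norm_num) x hx).1

end Literature.Geometry.Lorentzian.KlainermanSzeftel2021.LastSliceRateChain

end
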